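import Literature.NumberTheory.EllipticCurves.PrimaryTorsionLocalGoodReductionFrobeniusProofs
import Literature.NumberTheory.GaloisRepresentations.ConjugationDescent
import Literature.NumberTheory.GaloisRepresentations.ContinuousCohomologyBockstein
import Literature.NumberTheory.GaloisRepresentations.InertiaPadicCharacterProofs
import Literature.NumberTheory.Automorphic.AdicCompletionResidueCard
import HarnessLib

/-!
# Values on inertia of local cocycles of `E[p^∞]` at a good place `w ∤ p` lie in
# `ker(Frob_w − q_w)`, hence are killed by `#Ẽ_w(k_w)` — PROVED

Topic `NumberTheory/EllipticCurves`; namespace `WeierstrassCurve`. THEOREMS ONLY (no definition, no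
named fact, no instance, no `sorry`; D-0026). Cell `bsd-stepL` (typer lane `defn-ty1`, g9): the
tame-inertia step of module L4a ("`#H¹(K_w, E[p^∞]) = #E(K_w)[p^∞]` at a good `w ∤ p`",
[GreenbergLNM1716] §2; [Castella2018] Prop. 2.5) of the discharge plan for the named LOCAL fact
`JetchevSkinnerWan2017.sigmaLocal_charIdeal_eulerFactor_mem_of_noTamagawaDefect`
(`HOME/defn-ty1/g9/NOTE-sigmaLocal-discharge-plan-defn-ty1-g9.md`).

With `A = E[p^∞]` unramified at `w` (VII.4.1(b)), a continuous `1`-cocycle `z` of `Γ_{K_w}` restricts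
to a continuous HOMOMORPHISM on the inertia group `I_w`; it kills the wild inertia group `P_w`
(pro-`ℓ`, `ℓ ≠ p`), Frobenius conjugation acts on `I_w/P_w` by `u ↦ u^{q_w}` (Serre), and restricted
classes are Frobenius-invariant — so `Frob_w · z(σ) = z(Frob_w σ Frob_w⁻¹) = q_w · z(σ)` for
`σ ∈ I_w`: the values of `z` on inertia lie in `A(−1)^{Frob_w = 1} = ker(Frob_w − q_w | A)`, which
`PrimaryTorsionLocalGoodReductionFrobeniusProofs` shows is killed by `#Ẽ_w(k_w)`.

## What is proved

For an elliptic curve `W` over a number field `K`, a prime `p`, a finite place `w ∤ p` of GOOD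
reduction, the local Galois group `Γ_{K_w} = absoluteGaloisGroup K_w` acting on `E[p^∞]` through the
chosen restriction `absGaloisRestrict K K_w` (= `BigGaloisRep.localMap K (Sum.inl w)` by definition;
stated with `absGaloisRestrict` so that `Γ_{K_w}` carries its own instances), a continuous `1`-cocycle
`z`, an arithmetic Frobenius lift `φ ∈ Γ_{K_w}` and `σ ∈ I_{K_w} = absInertia K_w`:
* `cocycle_apply_mul_of_mem_absInertia`, `cocycle_apply_pow_of_mem_absInertia` — `z` is additive on
  `I_{K_w}`;
* `cocycle_apply_eq_zero_of_mem_absWildInertia` — `z` kills the wild inertia group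
  (`absWildInertia_isProP_holds`: `P_w` is pro-`ℓ`; the zero locus of `z` is an open subgroup,
  `isOpen_oneCocycleKer`; `ℓ` is invertible on `E[p^∞]`);
* `frob_apply_cocycle_apply_eq_cocycle_conj` — `ρ(φ) z(σ) = z(φ σ φ⁻¹)` (restricted classes are
  `Γ_{K_w}`-invariant, `conjMap_resSubgroup_one`, and coboundaries of the trivial `I_w`-module vanish);
* **`frob_apply_cocycle_apply_eq_residueCard_smul`** — `ρ(φ) z(σ) = q_w · z(σ)`
  (`conj_mul_pow_inv_mem_absWildInertia`: `φ σ φ⁻¹ σ^{-q} ∈ P_w`);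
* **`natCard_point_smul_cocycle_apply_eq_zero`** — `#Ẽ_w(k_w) · z(σ) = 0`
  (`natCard_point_smul_eq_zero_of_smul_eq_residueCard_smul`).

HONEST FRAMING: no cardinality of `H¹(K_w, E[p^∞])` is computed (what remains of L4a: a class is
determined by the values of an `I`-adapted representative on a topological generator of the `p`-part of
tame inertia, and the sharp count `#ker(Frob − q | E[pⁿ]) = #ker(Frob − 1 | E[pⁿ])` via the Weil pairing);
the named fact is NOT discharged by this file.

References: [SerreInventiones1972] §1.3, §1.8 Prop. 6; [SerreLocalFields1979] Ch. IV §2, VII §5;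
[GreenbergLNM1716] §2 (pp. 69–71); [Rubin2000] Lemma 1.3.2, §1.3; [Castella2018] Prop. 2.5.
Tree: `WildInertia` (`absWildInertia_isProP_holds`, `conj_mul_pow_inv_mem_absWildInertia`,
`absWildInertia_le_absInertia`), `ContinuousCohomologyBockstein` (`oneCocycleKer`), `ConjugationDescent`
(`conjMap_resSubgroup_one`), `PrimaryTorsionLocalGoodReductionFrobeniusProofs`.
-/

noncomputable section

open scoped Classical
open CategoryTheory Field ValuativeRel NumberField IsDedekindDomain IsDedekindDomain.HeightOneSpectrum
open Literature.NumberTheory.EllipticCurves Literature.NumberTheory.EllipticCurves.BigGaloisRep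
  Literature.NumberTheory.GaloisRepresentations Literature.NumberTheory.Automorphic
  Literature.NumberTheory.GaloisRepresentations.IsNonarchimedeanLocalField

namespace WeierstrassCurve

variable {K : Type} [Field K] [NumberField K] (W : WeierstrassCurve K) [W.IsElliptic]
  (p : ℕ) [Fact p.Prime] {w : HeightOneSpectrum (𝓞 K)} [ContinuousSMul ℤ_[p] (PrimaryTorsion (geomPoints W) p)]

/-! ## §1 A local cocycle is additive on inertia and kills wild inertia -/

omit [ContinuousSMul ℤ_[p] (PrimaryTorsion (geomPoints W) p)] in
/-- The inertia group acts trivially on `E[p^∞]` at a good `w ∤ p`, in `absGaloisRestrict` currency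
(`primaryTorsionGaloisRep_localMap_inr_apply`). [cite: SilvermanAEC2009, Prop. VII.4.1(b)] -/
theorem primaryTorsionGaloisRep_absGaloisRestrict_apply_of_mem_absInertia (hw : ((p : ℕ) : 𝓞 K) ∉ w.asIdeal)
    (hgood : W.HasGoodReductionAt w) {σ : absoluteGaloisGroup (w.adicCompletion K)}
    (hσ : σ ∈ absInertia (w.adicCompletion K)) (P : PrimaryTorsion (geomPoints W) p) :
    W.primaryTorsionGaloisRep p (absGaloisRestrict K (w.adicCompletion K) σ) P = P :=
  W.primaryTorsionGaloisRep_localMap_inr_apply p hgood hw ⟨σ, hσ⟩ P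

/-- On the inertia group (which acts trivially on `E[p^∞]` at a good `w ∤ p`) a continuous
`1`-cocycle of `Γ_{K_w}` is additive: `z(σ τ) = z(σ) + z(τ)` for `σ ∈ I_{K_w}`.
[cite: SilvermanAEC2009, Prop. VII.4.1(b)] [cite: SerreGaloisCohomology1997, I §2.2] -/
theorem cocycle_apply_mul_of_mem_absInertia (hw : ((p : ℕ) : 𝓞 K) ∉ w.asIdeal)
    (hgood : W.HasGoodReductionAt w)
    (z : contOneCocycles ((W.primaryTorsionGaloisRep p).restrict
      (absGaloisRestrict K (w.adicCompletion K))).toTopRep)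
    {σ : absoluteGaloisGroup (w.adicCompletion K)} (hσ : σ ∈ absInertia (w.adicCompletion K))
    (τ : absoluteGaloisGroup (w.adicCompletion K)) : z.1 (σ * τ) = z.1 σ + z.1 τ := by
  rw [z.2 σ τ]
  congr 1
  exact W.primaryTorsionGaloisRep_absGaloisRestrict_apply_of_mem_absInertia p hw hgood hσ (z.1 τ)

/-- `z(σⁿ) = n · z(σ)` for `σ` in the inertia group. [cite: SerreGaloisCohomology1997, I §2.2] -/
theorem cocycle_apply_pow_of_mem_absInertia (hw : ((p : ℕ) : 𝓞 K) ∉ w.asIdeal)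
    (hgood : W.HasGoodReductionAt w)
    (z : contOneCocycles ((W.primaryTorsionGaloisRep p).restrict
      (absGaloisRestrict K (w.adicCompletion K))).toTopRep)
    {σ : absoluteGaloisGroup (w.adicCompletion K)} (hσ : σ ∈ absInertia (w.adicCompletion K))
    (n : ℕ) : z.1 (σ ^ n) = n • z.1 σ := by
  induction n with
  | zero => rw [pow_zero, zero_smul]; exact contOneCocycles.apply_one z
  | succ n ih =>
    rw [pow_succ, W.cocycle_apply_mul_of_mem_absInertia p hw hgood z (pow_mem hσ n), ih, add_smul,
      one_smul]

omit [NumberField K] [W.IsElliptic] [ContinuousSMul ℤ_[p] (PrimaryTorsion (geomPoints W) p)] in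
/-- An integer prime to `p` acts injectively on `E[p^∞]` (it is a unit of `ℤ_p`). [cite: Lang1990, Ch. 5 §1] -/
theorem eq_zero_of_zsmul_eq_zero_of_not_dvd {m : ℤ} (hm : ¬ (p : ℤ) ∣ m)
    {y : PrimaryTorsion (geomPoints W) p} (hy : m • y = 0) : y = 0 := by
  have hu : IsUnit ((m : ℤ) : ℤ_[p]) := by
    rw [PadicInt.isUnit_iff]
    exact le_antisymm (PadicInt.norm_le_one _)
      (not_lt.1 fun h ↦ hm ((PadicInt.norm_int_lt_one_iff_dvd m).1 h))
  obtain ⟨u, hu⟩ := hu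
  have h1 : ((u : ℤ_[p]) : ℤ_[p]) • y = 0 := by rw [hu, Int.cast_smul_eq_zsmul, hy]
  have h2 := congrArg (fun t ↦ ((u⁻¹ : ℤ_[p]ˣ) : ℤ_[p]) • t) h1
  simp only [smul_smul, Units.inv_mul, one_smul, smul_zero] at h2
  exact h2

/-- **A local cocycle of `E[p^∞]` kills the wild inertia group** `P_{K_w}` at a good `w ∤ p`: the
zero locus of `z` is an open subgroup (`isOpen_oneCocycleKer`), `P_{K_w}` is pro-`ℓ`
(`absWildInertia_isProP_holds`: some `ω^{ℓ^a}` lies in it), `z` is additive on inertia, and `ℓ^a` is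
invertible on `E[p^∞]` (`ℓ = char k_w ≠ p`).
[cite: SerreLocalFields1979, Ch. IV §2 Cor. 3 of Prop. 7] [cite: SerreInventiones1972, §1.3] -/
theorem cocycle_apply_eq_zero_of_mem_absWildInertia (hw : ((p : ℕ) : 𝓞 K) ∉ w.asIdeal)
    (hgood : W.HasGoodReductionAt w)
    (z : contOneCocycles ((W.primaryTorsionGaloisRep p).restrict
      (absGaloisRestrict K (w.adicCompletion K))).toTopRep)
    {ϖ : 𝒪[w.adicCompletion K]} (hϖ : Irreducible ϖ)
    {ω : absoluteGaloisGroup (w.adicCompletion K)} (hω : ω ∈ absWildInertia (w.adicCompletion K) ϖ) :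
    z.1 ω = 0 := by
  obtain ⟨a, ha⟩ := absWildInertia_isProP_holds (w.adicCompletion K) hϖ hω (oneCocycleKer z)
    (isOpen_oneCocycleKer z)
  rw [mem_oneCocycleKer_iff, W.cocycle_apply_pow_of_mem_absInertia p hw hgood z
    (absWildInertia_le_absInertia _ ϖ hω)] at ha
  have hℓ : ¬ (p : ℤ) ∣ ((ringChar 𝓀[w.adicCompletion K] ^ a : ℕ) : ℤ) := by
    rw [Int.natCast_dvd_natCast]
    intro h
    exact w.ringChar_residueField_adicCompletion_ne hw
      (((Nat.prime_dvd_prime_iff_eq (Fact.out : p.Prime) ringChar_residueField_prime).mp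
        ((Fact.out : p.Prime).dvd_of_dvd_pow h)).symm)
  exact W.eq_zero_of_zsmul_eq_zero_of_not_dvd p hℓ (by rw [natCast_zsmul]; exact ha)

/-! ## §2 Frobenius on the values: `ρ(g) z(g⁻¹σg) = z(σ)`, `ρ(φ) z(σ) = z(φσφ⁻¹) = q_w · z(σ)` -/

/-- **Restricted classes are `Γ_{K_w}`-invariant, pointwise**: for a continuous `1`-cocycle `z` of
`Γ_{K_w}` with values in `E[p^∞]` (good `w ∤ p`), any `g ∈ Γ_{K_w}` and `σ ∈ I_{K_w}`:
`ρ(g) z(g⁻¹ σ g) = z(σ)` — the class `res_{I} [z] ∈ H¹(I_{K_w}, E[p^∞])` is `Γ_{K_w}`-invariant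
(`conjMap_resSubgroup_one`), and since `I_{K_w}` acts trivially the resulting coboundary vanishes.
[cite: SerreLocalFields1979, VII §5] [cite: SerreGaloisCohomology1997, I §2.6] -/
theorem apply_cocycle_conj_eq (hw : ((p : ℕ) : 𝓞 K) ∉ w.asIdeal) (hgood : W.HasGoodReductionAt w)
    (z : contOneCocycles ((W.primaryTorsionGaloisRep p).restrict
      (absGaloisRestrict K (w.adicCompletion K))).toTopRep)
    (g : absoluteGaloisGroup (w.adicCompletion K))
    {σ : absoluteGaloisGroup (w.adicCompletion K)} (hσ : σ ∈ absInertia (w.adicCompletion K)) :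
    W.primaryTorsionGaloisRep p (absGaloisRestrict K (w.adicCompletion K) g) (z.1 (g⁻¹ * σ * g)) = z.1 σ := by
  haveI : (absInertia (w.adicCompletion K)).Normal := absInertia_normal_holds (w.adicCompletion K)
  have hres := conjMap_resSubgroup_one
    ((W.primaryTorsionGaloisRep p).restrict (absGaloisRestrict K (w.adicCompletion K))).toTopRep
    (absInertia (w.adicCompletion K)) g
    (oneCocycleClass ((W.primaryTorsionGaloisRep p).restrict
      (absGaloisRestrict K (w.adicCompletion K))).toTopRep z)
  rw [resSubgroup_oneCocycleClass, conjMap_oneCocycleClass, ← sub_eq_zero, ← oneCocycleClass_sub,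
    oneCocycleClass_eq_zero_iff] at hres
  obtain ⟨b, hb⟩ := hres
  have h := hb ⟨σ, hσ⟩
  -- the coboundary on the right vanishes: `I` acts trivially
  have htriv : (subgroupRep ((W.primaryTorsionGaloisRep p).restrict
      (absGaloisRestrict K (w.adicCompletion K))).toTopRep (absInertia (w.adicCompletion K))).ρ
        ⟨σ, hσ⟩ b - b = 0 := by
    rw [subgroupRep_ρ_apply, sub_eq_zero]
    exact W.primaryTorsionGaloisRep_absGaloisRestrict_apply_of_mem_absInertia p hw hgood hσ b
  rw [htriv] at h
  -- unfold the left side: `(g·z|_I − z|_I)(σ) = ρ(g) z(g⁻¹σg) − z(σ)` (definitional)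
  have e1 : W.primaryTorsionGaloisRep p (absGaloisRestrict K (w.adicCompletion K) g)
      (z.1 (g⁻¹ * σ * g)) - z.1 σ = 0 := h
  rwa [sub_eq_zero] at e1

/-- **`ρ(φ) z(σ) = z(φ σ φ⁻¹)`** for `σ ∈ I_{K_w}` (the previous lemma at `g = φ`, `σ ↦ φσφ⁻¹`).
[cite: SerreLocalFields1979, VII §5] -/
theorem frob_apply_cocycle_apply_eq_cocycle_conj (hw : ((p : ℕ) : 𝓞 K) ∉ w.asIdeal)
    (hgood : W.HasGoodReductionAt w)
    (z : contOneCocycles ((W.primaryTorsionGaloisRep p).restrict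
      (absGaloisRestrict K (w.adicCompletion K))).toTopRep)
    (φ : absoluteGaloisGroup (w.adicCompletion K))
    {σ : absoluteGaloisGroup (w.adicCompletion K)} (hσ : σ ∈ absInertia (w.adicCompletion K)) :
    W.primaryTorsionGaloisRep p (absGaloisRestrict K (w.adicCompletion K) φ) (z.1 σ) =
      z.1 (φ * σ * φ⁻¹) := by
  haveI : (absInertia (w.adicCompletion K)).Normal := absInertia_normal_holds (w.adicCompletion K)
  have hσ' : φ * σ * φ⁻¹ ∈ absInertia (w.adicCompletion K) :=
    Subgroup.Normal.conj_mem inferInstance σ hσ φ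
  have h := W.apply_cocycle_conj_eq p hw hgood z φ hσ'
  rwa [show φ⁻¹ * (φ * σ * φ⁻¹) * φ = σ by group] at h

/-- **`ρ(φ) z(σ) = q_w · z(σ)` for `σ ∈ I_{K_w}`** and an arithmetic Frobenius lift `φ` (good
`w ∤ p`): `φ σ φ⁻¹ = ω σ^{q_w}` with `ω ∈ P_{K_w}` (`conj_mul_pow_inv_mem_absWildInertia`: Frobenius
acts on tame inertia by `u ↦ u^q`), `z(ω) = 0`, and `z` is additive on inertia.  The values of `z` on
inertia thus lie in `E[p^∞](−1)^{Frob_w = 1} = ker(Frob_w − q_w | E[p^∞])`.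
[cite: SerreInventiones1972, §1.8 Prop. 6] [cite: GreenbergLNM1716, §2 (p. 71)] [cite: Rubin2000, Lemma 1.3.2] -/
theorem frob_apply_cocycle_apply_eq_residueCard_smul (hw : ((p : ℕ) : 𝓞 K) ∉ w.asIdeal)
    (hgood : W.HasGoodReductionAt w)
    (z : contOneCocycles ((W.primaryTorsionGaloisRep p).restrict
      (absGaloisRestrict K (w.adicCompletion K))).toTopRep)
    {φ : absoluteGaloisGroup (w.adicCompletion K)} (hφ : IsFrobPow φ 1)
    {σ : absoluteGaloisGroup (w.adicCompletion K)} (hσ : σ ∈ absInertia (w.adicCompletion K)) :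
    W.primaryTorsionGaloisRep p (absGaloisRestrict K (w.adicCompletion K) φ) (z.1 σ) =
      (residueFieldCard (w.adicCompletion K) : ℤ) • z.1 σ := by
  obtain ⟨ϖ, hϖ⟩ := IsDiscreteValuationRing.exists_irreducible 𝒪[w.adicCompletion K]
  have hφ' : IsFrobPow φ ((1 : ℕ) : ℤ) := by simpa using hφ
  have hmem := conj_mul_pow_inv_mem_absWildInertia hϖ.ne_zero hφ' hσ
  rw [pow_one] at hmem
  have hωI : φ * σ * φ⁻¹ * (σ ^ residueFieldCard (w.adicCompletion K))⁻¹ ∈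
      absInertia (w.adicCompletion K) := absWildInertia_le_absInertia _ ϖ hmem
  have hconj : φ * σ * φ⁻¹ =
      φ * σ * φ⁻¹ * (σ ^ residueFieldCard (w.adicCompletion K))⁻¹ *
        σ ^ residueFieldCard (w.adicCompletion K) := by
    rw [inv_mul_cancel_right]
  rw [W.frob_apply_cocycle_apply_eq_cocycle_conj p hw hgood z φ hσ, hconj,
    W.cocycle_apply_mul_of_mem_absInertia p hw hgood z hωI,
    W.cocycle_apply_eq_zero_of_mem_absWildInertia p hw hgood z hϖ hmem, zero_add,
    W.cocycle_apply_pow_of_mem_absInertia p hw hgood z hσ, natCast_zsmul]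

/-- **The values on inertia of a local cocycle of `E[p^∞]` are killed by `#Ẽ_w(k_w)`** (good
`w ∤ p`): combine `frob_apply_cocycle_apply_eq_residueCard_smul` (`ρ(φ) z(σ) = q_w z(σ)`) with
Cayley–Hamilton at the eigenvalue `q_w` (`natCard_point_smul_eq_zero_of_smul_eq_residueCard_smul`).
[cite: GreenbergLNM1716, §2 (p. 71)] [cite: SilvermanAEC2009, C.21 Remark 21.3] -/
theorem natCard_point_smul_cocycle_apply_eq_zero (hw : ((p : ℕ) : 𝓞 K) ∉ w.asIdeal)
    (hgood : W.HasGoodReductionAt w)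
    (z : contOneCocycles ((W.primaryTorsionGaloisRep p).restrict
      (absGaloisRestrict K (w.adicCompletion K))).toTopRep)
    {σ : absoluteGaloisGroup (w.adicCompletion K)} (hσ : σ ∈ absInertia (w.adicCompletion K)) :
    (Nat.card (W.reductionAt w).toAffine.Point : ℤ) • z.1 σ = 0 := by
  obtain ⟨φ, hφ⟩ := WeierstrassCurve.exists_isFrobPow_one_adicCompletion (K := K) w
  have h := W.frob_apply_cocycle_apply_eq_residueCard_smul p hw hgood z hφ hσ
  rw [residueFieldCard_adicCompletion_eq K w,
    show (w.residueCard : ℤ) = (Nat.card (IsLocalRing.ResidueField (w.adicCompletionIntegers K)) : ℤ) by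
      rw [natCard_residueField_adicCompletionIntegers_eq_absNorm]; rfl] at h
  exact W.natCard_point_smul_eq_zero_of_smul_eq_residueCard_smul p hw hgood hφ h

end WeierstrassCurve

end
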